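import Summits.HodgeConjecture.CorCM.Census.FermatTypesCyclotomic
import HarnessLib

/-!
# Every CM type of `ℚ(ζ₂₁) = ℚ(ζ₄₂)` (C₆ × C₂, degree 12) is a translate of a Fermat type of level `42` — kernel census, sequel

Sequel of `CorCM/Census/FermatTypesCyclotomic.lean` (same model `units / cmTypes / fermatType / translate`, same dictionary
[cite: KoblitzRohrlich1978, §1 pp. 1183–1184]; Aoki level `42 = 2·3·7` [cite: Aoki2002CMFermatType, Thm 1.2 (ii)]): the `64` CM types of `(ℤ/42)ˣ` are exactly the
unit-translates `g · H_{a,b,-(a+b)}` named by the witness table `W42` (seat script `scratch/fermat_witness.py`), so every product of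
CM abelian varieties with CM types of `ℚ(ζ₂₁) = ℚ(ζ₄₂)` is an isogeny factor of a power of `J(F_{42})`, and its Hodge classes are
algebraic in print (Aoki 2002 Thm 1.2 = tree record `Aoki2002_hodgeClasses_algebraic_fermatJacobianPowers`, summit spelling
`Theorems.hodgeConjectureFor_isogenyFactor_fermatJacobian`); in particular the `ℚ(ζ₂₁) = ℚ(ζ₄₂)` slice of `Universe.W_RK4` (COR-CM,
`CorCM/Geometry/Statements.lean`) asserts nothing beyond print.  One level per file keeps the kernel evaluation inside the
farm's single-file budget.  Portfolio note: `HOME/pub-hodgecm2-lit-andre-3/PORTFOLIO-lit-andre-3-g2.md` §4.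
-/

namespace Summit.HodgeConjecture.CorCM.Census.FermatTypesCyclotomic

open Finset

/-- witnesses for `m = 42: 64 CM types`. [folklore] -/
def W42 : List (ZMod 42 × ZMod 42 × ZMod 42) := [(1, 1, 1), (1, 1, 13), (1, 1, 14), (5, 1, 1), (17, 1, 14), (1, 1, 6), (5, 1, 3), (1, 2, 12), (17, 2, 12), (23, 1, 1), (5, 1, 6), (5, 1, 13), (1, 1, 3), (23, 1, 14), (31, 1, 14), (31, 1, 1), (11, 1, 13), (13, 1, 1), (11, 1, 6), (11, 2, 12), (17, 1, 1), (37, 2, 12), (29, 2, 12), (1, 2, 8), (17, 1, 6), (13, 1, 14), (1, 7, 7), (23, 1, 6), (37, 1, 14), (17, 1, 3), (29, 1, 6), (23, 2, 12), (19, 2, 12), (13, 1, 6), (11, 1, 3), (5, 1, 14), (19, 1, 6), (5, 7, 7), (29, 1, 14), (25, 1, 6), (5, 2, 8), (13, 2, 12), (5, 2, 12), (25, 1, 1), (31, 2, 12), (31, 1, 6), (29, 1, 1), (25, 1, 13), (11, 1, 1), (11, 1, 14), (19, 1, 14), (13, 1, 3), (19, 1, 13), (37, 1, 6), (19, 1,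 1), (25, 2, 12), (41, 2, 12), (23, 1, 3), (41, 1, 6), (25, 1, 14), (37, 1, 1), (41, 1, 14), (29, 1, 13), (41, 1, 1)]

set_option maxRecDepth 16000 in
set_option maxHeartbeats 8000000 in
/-- **`ℚ(ζ_{21})`** (C₆ × C₂, degree 12; level 42 = 2·21): there are `64` CM types of `(ℤ/42)ˣ`, every witness is admissible, and the set of translates
`g · H_{a,b,-(a+b)}` named by the witnesses IS the set of all CM types — so every isogeny class of CM abelian varieties with a CM
type of `ℚ(ζ_{21})` is a Fermat class of level `42`. [cite: KoblitzRohrlich1978, §1 pp. 1183–1184] -/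
theorem cover42 : (cmTypes 42).card = 64 ∧ (∀ w ∈ W42, admissible 42 w = true) ∧
    (W42.map (translate 42)).toFinset = cmTypes 42 := by
  refine ⟨by decide +kernel, by decide +kernel, by decide +kernel⟩

end Summit.HodgeConjecture.CorCM.Census.FermatTypesCyclotomic
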